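import Summits.CriticalPhenomena.Ising3DConformalLimit.Theorems.PrecisionLaplacianDirectCorrelationStableTailPickInversionAux17

/-!
# Green-to-direct-correlation transfer of the mass gap, auxiliary file 3:
# from good transverse momenta to the whole reduced zone

Helper file for the sub-stub `stub_slabModeExpDecay_auxGreenTransfer` (brick of
`stub_slabModeExpDecay`) of line `self-energy-pick-inversion`, crux
`PrecisionLaplacian.DirectCorrelationStableTail` (stmt-CriticalPhenomena-4799). Pure theorem file.

The G-side decay hypothesis of the brick is only available at GOOD transverse momenta (the open cube
`(-π, π)²` off the axes `{k_j = 0}`), where it yields the gap inequality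
`F (n+1) k ≤ e^{-c'‖k‖} F n k` (`n ≥ 1`) for the slab modes `F n` of the direct correlation function.
This file passes the gap inequality to EVERY reduced momentum `k ∈ [-π, π]²`
(`gap_of_gap_at_good_momenta`, registered sub-goal `stub_slabModeExpDecay_auxGreenTransfer4`): reduce
`k` modulo `2πℤ²` to a limit `k'` of good momenta (`exists_reduce_approx`, file `…PickInversionAux17`),
pass to the limit using the continuity of the `F n` and of the sup norm, and transport back with the
`2π`-periodicity of the `F n` and the invariance of the sup norm (`|k_j| = |k'_j|` coordinatewise, since
both lie in `[-π, π]` and differ by a multiple of `2π`).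
-/

noncomputable section

namespace Summit.CriticalPhenomena.Ising3DConformalLimit.Cruxes.DirectCorrelationStableTail.SelfEnergyPickInversion

open Filter Topology Real
open scoped BigOperators

/-! ### The sup norm on the reduced zone is invariant under reduction modulo `2π` -/

/-- Two reals of `[-π, π]` differing by an integer multiple of `2π` have the same absolute value.
[folklore] -/
theorem abs_eq_abs_of_eq_add_int_mul_two_pi {x y : ℝ} {m : ℤ} (hx : |x| ≤ π) (hy : |y| ≤ π)
    (h : x = y + (m : ℝ) * (2 * π)) : |x| = |y| := by
  have h1 : Real.arccos (Real.cos |x|) = |x| := Real.arccos_cos (abs_nonneg x) hx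
  have h2 : Real.arccos (Real.cos |y|) = |y| := Real.arccos_cos (abs_nonneg y) hy
  rw [← h1, ← h2, Real.cos_abs, Real.cos_abs, h, Real.cos_add_int_mul_two_pi]

/-- The sup norm of `k : Fin 2 → ℝ` only depends on the coordinatewise absolute values. [folklore] -/
theorem norm_eq_norm_of_abs_eq {k k' : Fin 2 → ℝ} (h : ∀ j, |k j| = |k' j|) : ‖k‖ = ‖k'‖ := by
  have h1 : ∀ j, ‖k j‖₊ = ‖k' j‖₊ := fun j => by
    ext; rw [coe_nnnorm, coe_nnnorm, Real.norm_eq_abs, Real.norm_eq_abs, h j]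
  simp only [Pi.norm_def, h1]

/-! ### From good momenta to the reduced zone -/

/-- **The gap inequality passes from good momenta to the whole reduced zone.** Let `F n`
(`n ≥ 1`) be continuous `2πℤ²`-periodic functions on `ℝ²` such that at every good momentum `k`
(`|k_j| < π` for all `j`, some `k_j ≠ 0`) the gap inequality `F (n+1) k ≤ e^{-c'‖k‖} F n k` holds for
all `n ≥ 1`. Then it holds at every `k` of the reduced zone `[-π, π]²`. [folklore] -/
theorem gap_of_gap_at_good_momenta {F : ℕ → (Fin 2 → ℝ) → ℝ} (hcont : ∀ n, 1 ≤ n → Continuous (F n))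
    (hper : ∀ (n : ℕ) (k' : Fin 2 → ℝ) (m : Fin 2 → ℤ), F n (fun j => k' j + (m j : ℝ) * (2 * π)) = F n k')
    (c' : ℝ)
    (hgood : ∀ k : Fin 2 → ℝ, (∀ j, |k j| < π) → (∃ j, k j ≠ 0) → ∀ n : ℕ, 1 ≤ n →
      F (n + 1) k ≤ Real.exp (-(c' * ‖k‖)) * F n k)
    (k : Fin 2 → ℝ) (hk : ∀ j, |k j| ≤ π) (n : ℕ) (hn : 1 ≤ n) :
    F (n + 1) k ≤ Real.exp (-(c' * ‖k‖)) * F n k := by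
  obtain ⟨k', m, km, hkk', hlim, hkm⟩ := exists_reduce_approx k
  have hkfun : k = fun j => k' j + (m j : ℝ) * (2 * π) := funext hkk'
  have hFk : ∀ n, F n k = F n k' := fun n => by rw [hkfun, hper]
  -- `k'` lies in the closed reduced zone and has the same sup norm as `k`
  have hk' : ∀ j, |k' j| ≤ π := fun j => by
    have h1 : Tendsto (fun N => |km N j|) atTop (𝓝 |k' j|) :=
      (continuous_abs.tendsto _).comp ((continuous_apply j).continuousAt.tendsto.comp hlim)
    exact le_of_tendsto' h1 fun N => ((hkm N).1 j).le
  have habs : ∀ j, |k j| = |k' j| := fun j => abs_eq_abs_of_eq_add_int_mul_two_pi (hk j) (hk' j) (hkk' j)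
  rw [hFk, hFk, norm_eq_norm_of_abs_eq habs]
  -- pass to the limit along the good momenta `km N → k'`
  have hL : Tendsto (fun N => F (n + 1) (km N)) atTop (𝓝 (F (n + 1) k')) :=
    ((hcont (n + 1) (by omega)).tendsto k').comp hlim
  have hRc : Continuous fun k : Fin 2 → ℝ => Real.exp (-(c' * ‖k‖)) * F n k :=
    (Real.continuous_exp.comp (continuous_const.mul continuous_norm).neg).mul (hcont n hn)
  have hR : Tendsto (fun N => Real.exp (-(c' * ‖km N‖)) * F n (km N)) atTop
      (𝓝 (Real.exp (-(c' * ‖k'‖)) * F n k')) := (hRc.tendsto k').comp hlim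
  exact le_of_tendsto_of_tendsto' hL hR fun N => hgood (km N) (hkm N).1 (hkm N).2 n hn

/-- **Registered auxiliary stub `stub_slabModeExpDecay_auxGreenTransfer4`** (sub-goal of the brick
`stub_slabModeExpDecay_auxGreenTransfer` of `stub_slabModeExpDecay`): the gap inequality for a
continuous `2πℤ²`-periodic family passes from the good momenta to the whole reduced zone
(`gap_of_gap_at_good_momenta`). [folklore] -/
theorem stub_slabModeExpDecay_auxGreenTransfer4 : ∀ (F : ℕ → (Fin 2 → ℝ) → ℝ) (c' : ℝ),
    (∀ n : ℕ, 1 ≤ n → Continuous (F n)) →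
    (∀ (n : ℕ) (k' : Fin 2 → ℝ) (m : Fin 2 → ℤ), F n (fun j => k' j + (m j : ℝ) * (2 * Real.pi)) = F n k') →
    (∀ k : Fin 2 → ℝ, (∀ j, |k j| < Real.pi) → (∃ j, k j ≠ 0) → ∀ n : ℕ, 1 ≤ n →
      F (n + 1) k ≤ Real.exp (-(c' * ‖k‖)) * F n k) →
    ∀ k : Fin 2 → ℝ, (∀ j, |k j| ≤ Real.pi) → ∀ n : ℕ, 1 ≤ n → F (n + 1) k ≤ Real.exp (-(c' * ‖k‖)) * F n k :=
  fun _ c' hcont hper hgood k hk n hn => gap_of_gap_at_good_momenta hcont hper c' hgood k hk n hn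

end Summit.CriticalPhenomena.Ising3DConformalLimit.Cruxes.DirectCorrelationStableTail.SelfEnergyPickInversion

end
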